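import Mathlib.Analysis.Complex.AbsMax
import Mathlib.Analysis.Complex.CauchyIntegral
import Mathlib.Analysis.Analytic.IsolatedZeros
import Mathlib.Analysis.SpecialFunctions.Complex.LogDeriv
import Mathlib.Analysis.SpecialFunctions.Complex.Log
import Mathlib.Analysis.SpecificLimits.Basic
import Literature.Analysis.Complex.Hurwitz
import HarnessLib

/-!
# Accumulation of zeros at an equimodular point of two dominant holomorphic branches

The analytic core of the **Beraha–Kahane–Weiss theorem** (PNAS 72 (1975) 4209, Theorem,
nondegenerate two-branch case; textbook account: Salas–Sokal, J. Stat. Phys. 104 (2001) 609,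
§2.2): if `l₀, l₁, a, b` are holomorphic near `z₀`, `l₀ ≠ 0`, `‖l₁ z₀‖ = ‖l₀ z₀‖`
(equimodularity), `l₁ / l₀` is not constant and `a z₀ ≠ 0 ≠ b z₀`, then for every `ε > 0` and ALL
large `t` the function `a·l₀^t + b·l₁^t + R_t` — `R_t` holomorphic, `‖R_t‖ ≤ C θ^t ‖l₀‖^t`,
`θ < 1` — has a zero in `B(z₀, ε)`: the mechanism by which zeros of `Tr T(z)^t = Σᵢ λᵢ(z)^t`
(partition functions of `L × t` strips / tubes) accumulate, as `t → ∞`, on the equimodular curves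
of the two top eigenvalue branches of a holomorphic transfer-operator family.

* `exists_ball_differentiableOn_exp_eq` — a local holomorphic logarithm;
* `exists_zero_near_equimodular_point` — the accumulation theorem.

Proof (no argument principle): `b l₁^t / (a l₀^t) = exp (t Λ + m)` with local logarithms,
`Re Λ(z₀) = 0`; with the nearest odd multiple of `πi`, `W_t = t Λ + m − (2k_t+1)πi` has
`W_t(z₀) = O(1)`, so `W_t / t → Λ − Λ(z₀)` uniformly on a small closed disc, where `Λ − Λ(z₀)` has
an ISOLATED zero at `z₀` (identity theorem, else `l₁ = c·l₀`); Hurwitz's theorem gives a zero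
`z_t` of `W_t` near `z₀`.  On `U_t = {‖W_t‖ < 1/2} ∩ disc` the frontier carries `‖W_t‖ = 1/2`
(as `‖W_t‖ ≥ 1` on the circle), so `‖1 − e^{W_t}‖ ≥ 1/4` there, while
`G_t = 1 − e^{W_t} + R_t/(a l₀^t)` has `‖G_t(z_t)‖ < 1/8`; the maximum modulus principle for
`1/G_t` on `U_t` yields a zero of `G_t`, i.e. of `a l₀^t + b l₁^t + R_t = a l₀^t · G_t`.

## References

* S. Beraha, J. Kahane, N. J. Weiss, PNAS 72 (1975) 4209. [BerahaKahaneWeiss1975]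
* J. Salas, A. D. Sokal, J. Stat. Phys. 104 (2001) 609–699, §2.2. [SalasSokal2001]
* J. B. Conway, *Functions of one complex variable I*, Ch. VII Thm. 2.5 (Hurwitz). [Conway1978]
-/

noncomputable section

open Filter Metric Set Topology
open _root_.Complex

namespace Literature.Analysis.Complex

/-- **Local holomorphic logarithm.** A function holomorphic on `ball z₀ ρ` that does not vanish at
`z₀` is `exp ∘ L` on a smaller ball for some holomorphic `L` with `L z₀ = log (f z₀)`
(`L z = log (f z / f z₀) + log (f z₀)`, the principal logarithm near `1`). [folklore] -/
theorem exists_ball_differentiableOn_exp_eq {f : ℂ → ℂ} {z₀ : ℂ} {ρ : ℝ} (hρ : 0 < ρ)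
    (hf : DifferentiableOn ℂ f (ball z₀ ρ)) (h0 : f z₀ ≠ 0) :
    ∃ ρ₁ : ℝ, 0 < ρ₁ ∧ ρ₁ ≤ ρ ∧ ∃ L : ℂ → ℂ, DifferentiableOn ℂ L (ball z₀ ρ₁) ∧
      L z₀ = log (f z₀) ∧ ∀ z ∈ ball z₀ ρ₁, exp (L z) = f z := by
  have hcont : ContinuousAt f z₀ := hf.continuousOn.continuousAt (ball_mem_nhds z₀ hρ)
  have hpos : 0 < ‖f z₀‖ := norm_pos_iff.2 h0
  obtain ⟨ρ₁, hρ₁, hclose⟩ := Metric.continuousAt_iff.1 hcont ‖f z₀‖ hpos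
  refine ⟨min ρ₁ ρ, lt_min hρ₁ hρ, min_le_right _ _, fun z => log (f z / f z₀) + log (f z₀),
    ?_, ?_, ?_⟩
  · intro z hz
    have hzρ : z ∈ ball z₀ ρ := ball_subset_ball (min_le_right _ _) hz
    have hz₁ : dist z z₀ < ρ₁ := lt_of_lt_of_le (mem_ball.1 hz) (min_le_left _ _)
    have hslit : f z / f z₀ ∈ slitPlane := by
      have h1 : ‖f z / f z₀ - 1‖ < 1 := by
        rw [div_sub_one h0, norm_div, div_lt_one hpos, ← dist_eq_norm]
        exact hclose hz₁
      have h2 := Complex.mem_slitPlane_of_norm_lt_one h1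
      rwa [add_sub_cancel] at h2
    have hdf : DifferentiableAt ℂ f z := hf.differentiableAt (isOpen_ball.mem_nhds hzρ)
    exact (((hdf.div_const (f z₀)).clog hslit).add_const _).differentiableWithinAt
  · simp [div_self h0]
  · intro z hz
    have hz₁ : dist z z₀ < ρ₁ := lt_of_lt_of_le (mem_ball.1 hz) (min_le_left _ _)
    have hfz : f z ≠ 0 := by
      intro hfz
      have h := hclose hz₁
      rw [hfz, dist_eq_norm, zero_sub, norm_neg] at h
      exact lt_irrefl _ h
    rw [exp_add, exp_log (div_ne_zero hfz h0), exp_log h0, div_mul_cancel₀ _ h0]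

/-- `‖1 - exp w‖ ≥ 1/4` on the circle `‖w‖ = 1/2` (from `‖exp w - 1 - w‖ ≤ ‖w‖²`). [folklore] -/
theorem norm_one_sub_exp_ge_quarter {w : ℂ} (hw : ‖w‖ = 1 / 2) : 1 / 4 ≤ ‖1 - exp w‖ := by
  have h1 : ‖exp w - 1 - w‖ ≤ ‖w‖ ^ 2 := norm_exp_sub_one_sub_id_le (by rw [hw]; norm_num)
  have h2 : ‖w‖ - ‖exp w - 1 - w‖ ≤ ‖exp w - 1‖ := by
    have := norm_sub_norm_le w (-(exp w - 1 - w))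
    rw [norm_neg] at this
    have h3 : w - -(exp w - 1 - w) = exp w - 1 := by ring
    rw [h3] at this
    linarith
  rw [← norm_neg, neg_sub]
  rw [hw] at h1 h2
  nlinarith

/-- `exp (x - (2k+1)πi) = -exp x`. [folklore] -/
theorem exp_sub_odd_mul_pi_mul_I (x : ℂ) (k : ℤ) :
    exp (x - (2 * (k : ℂ) + 1) * Real.pi * I) = -exp x := by
  have h : x - (2 * (k : ℂ) + 1) * Real.pi * I = x + ((-k - 1 : ℤ) : ℂ) * (2 * Real.pi * I) + Real.pi * I := by
    push_cast; ring
  rw [h, exp_add, exp_add, exp_int_mul_two_pi_mul_I, exp_pi_mul_I]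
  ring

/-- **Accumulation of zeros at an equimodular point (Beraha–Kahane–Weiss mechanism).**
Let `l₀, l₁, a, b` be holomorphic on `ball z₀ ρ`, `l₀` zero-free there, `‖l₁ z₀‖ = ‖l₀ z₀‖`,
`a z₀ ≠ 0`, `b z₀ ≠ 0`, and `l₁` not a constant multiple of `l₀` on the ball.  Let `R t` be
holomorphic on the ball with `‖R t z‖ ≤ C θ^t ‖l₀ z‖^t`, `0 ≤ θ < 1`.  Then for every `ε > 0`
there is `t₀` such that for all `t ≥ t₀` the function `a·l₀^t + b·l₁^t + R t` has a zero in
`ball z₀ ε`. [cite: BerahaKahaneWeiss1975, Theorem (nondegenerate case, two dominant branches)] -/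
theorem exists_zero_near_equimodular_point (l₀ l₁ a b : ℂ → ℂ) (z₀ : ℂ) (ρ θ C : ℝ)
    (hρ : 0 < ρ) (hθ₀ : 0 ≤ θ) (hθ₁ : θ < 1) (hC : 0 ≤ C)
    (hl₀ : DifferentiableOn ℂ l₀ (ball z₀ ρ)) (hl₁ : DifferentiableOn ℂ l₁ (ball z₀ ρ))
    (ha : DifferentiableOn ℂ a (ball z₀ ρ)) (hb : DifferentiableOn ℂ b (ball z₀ ρ))
    (hl₀ne : ∀ z ∈ ball z₀ ρ, l₀ z ≠ 0) (heq : ‖l₁ z₀‖ = ‖l₀ z₀‖) (ha₀ : a z₀ ≠ 0)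
    (hb₀ : b z₀ ≠ 0) (hnc : ¬ ∃ c : ℂ, ∀ z ∈ ball z₀ ρ, l₁ z = c * l₀ z)
    (R : ℕ → ℂ → ℂ) (hR : ∀ t : ℕ, DifferentiableOn ℂ (R t) (ball z₀ ρ))
    (hRle : ∀ (t : ℕ) (z : ℂ), z ∈ ball z₀ ρ → ‖R t z‖ ≤ C * θ ^ t * ‖l₀ z‖ ^ t)
    (ε : ℝ) (hε : 0 < ε) :
    ∃ t₀ : ℕ, ∀ t : ℕ, t₀ ≤ t → ∃ z ∈ ball z₀ ε, a z * l₀ z ^ t + b z * l₁ z ^ t + R t z = 0 := by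
  classical
  /- Step 0: non-vanishing at `z₀`; the quotients `φ = l₁/l₀`, `ψ = b/a`. -/
  have hz₀ : z₀ ∈ ball z₀ ρ := mem_ball_self hρ
  have hl₀z₀ : l₀ z₀ ≠ 0 := hl₀ne z₀ hz₀
  have hl₁z₀ : l₁ z₀ ≠ 0 := fun h0 => by
    rw [h0, norm_zero] at heq; exact hl₀z₀ (norm_eq_zero.1 heq.symm)
  set φ : ℂ → ℂ := fun z => l₁ z / l₀ z with hφ
  have hφd : DifferentiableOn ℂ φ (ball z₀ ρ) := hl₁.div hl₀ hl₀ne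
  have hφ₀ : φ z₀ ≠ 0 := div_ne_zero hl₁z₀ hl₀z₀
  have hφnorm : ‖φ z₀‖ = 1 := by
    simp only [hφ]; rw [norm_div, heq, div_self (norm_ne_zero_iff.2 hl₀z₀)]
  obtain ⟨ρa, hρa, hρaρ, haNe⟩ : ∃ ρa, 0 < ρa ∧ ρa ≤ ρ ∧ ∀ z ∈ ball z₀ ρa, a z ≠ 0 := by
    have hcont : ContinuousAt a z₀ := ha.continuousOn.continuousAt (ball_mem_nhds z₀ hρ)
    obtain ⟨r, hr, hclose⟩ := Metric.continuousAt_iff.1 hcont ‖a z₀‖ (norm_pos_iff.2 ha₀)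
    refine ⟨min r ρ, lt_min hr hρ, min_le_right _ _, fun z hz h0 => ?_⟩
    have h1 := hclose (lt_of_lt_of_le (mem_ball.1 hz) (min_le_left _ _))
    rw [h0, dist_eq_norm, zero_sub, norm_neg] at h1; exact lt_irrefl _ h1
  set ψ : ℂ → ℂ := fun z => b z / a z with hψ
  have hψd : DifferentiableOn ℂ ψ (ball z₀ ρa) :=
    (hb.mono (ball_subset_ball hρaρ)).div (ha.mono (ball_subset_ball hρaρ)) haNe
  have hψ₀ : ψ z₀ ≠ 0 := div_ne_zero hb₀ ha₀
  /- Step 1: local logarithms `Λ` of `φ` and `m` of `ψ`; `Re Λ z₀ = 0`. -/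
  obtain ⟨ρ₁, hρ₁, hρ₁ρ, Λ, hΛd, hΛ₀, hΛexp⟩ := exists_ball_differentiableOn_exp_eq hρ hφd hφ₀
  obtain ⟨ρ₂, hρ₂, hρ₂ρ, m, hmd, -, hmexp⟩ := exists_ball_differentiableOn_exp_eq hρa hψd hψ₀
  have hReΛ : (Λ z₀).re = 0 := by rw [hΛ₀, log_re, hφnorm, Real.log_one]
  set Λ₀ : ℂ → ℂ := fun z => Λ z - Λ z₀ with hΛ₀def
  have hΛ₀d : DifferentiableOn ℂ Λ₀ (ball z₀ ρ₁) := hΛd.sub_const _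
  have hΛ₀an : AnalyticAt ℂ Λ₀ z₀ := (hΛ₀d.analyticOnNhd isOpen_ball) z₀ (mem_ball_self hρ₁)
  have hΛ₀z₀ : Λ₀ z₀ = 0 := sub_self _
  /- Step 2: `Λ₀` is not identically zero near `z₀` (else `l₁ = φ(z₀) · l₀` on the ball). -/
  have hnotev : ¬ (∀ᶠ z in 𝓝 z₀, Λ₀ z = 0) := by
    refine fun hev => hnc ⟨φ z₀, ?_⟩
    have hgan : AnalyticOnNhd ℂ (fun z => l₁ z - φ z₀ * l₀ z) (ball z₀ ρ) :=
      (hl₁.sub (hl₀.const_mul _)).analyticOnNhd isOpen_ball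
    have hev' : ∀ᶠ z in 𝓝 z₀, l₁ z - φ z₀ * l₀ z = 0 := by
      have hball : ∀ᶠ z in 𝓝 z₀, z ∈ ball z₀ ρ₁ := isOpen_ball.mem_nhds (mem_ball_self hρ₁)
      filter_upwards [hev, hball] with z hz hzb
      have hzρ : z ∈ ball z₀ ρ := ball_subset_ball hρ₁ρ hzb
      have h1 : φ z = φ z₀ := by
        rw [← hΛexp z hzb, (sub_eq_zero.1 hz : Λ z = Λ z₀), hΛexp z₀ (mem_ball_self hρ₁)]
      have h3 : l₁ z = φ z₀ * l₀ z := by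
        rw [← h1]; simp only [hφ]; rw [div_mul_cancel₀ _ (hl₀ne z hzρ)]
      rw [h3, sub_self]
    have hEq := hgan.eqOn_zero_of_preconnected_of_eventuallyEq_zero
      (convex_ball z₀ ρ).isPreconnected hz₀ hev'
    exact fun z hz => sub_eq_zero.1 (by simpa only [Pi.zero_apply] using hEq hz)
  have hiso : ∀ᶠ z in 𝓝[≠] z₀, Λ₀ z ≠ 0 :=
    (hΛ₀an.eventually_eq_zero_or_eventually_ne_zero).resolve_left hnotev
  /- Step 3: a closed disc of radius `δ` inside everything, with `Λ₀ ≠ 0` off the centre. -/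
  set ρ₃ := min ρ₁ ρ₂ with hρ₃
  have hρ₃pos : 0 < ρ₃ := lt_min hρ₁ hρ₂
  obtain ⟨δ, hδ, hδρ₃, hδε, hΛ₀ne⟩ : ∃ δ, 0 < δ ∧ δ < ρ₃ ∧ δ < ε ∧
      ∀ z ∈ closedBall z₀ δ, z ≠ z₀ → Λ₀ z ≠ 0 := by
    obtain ⟨r, hr, hball⟩ := Metric.eventually_nhds_iff_ball.1 (eventually_nhdsWithin_iff.1 hiso)
    refine ⟨min (r / 2) (min (ρ₃ / 2) (ε / 2)), by positivity, ?_, ?_, fun z hz hne => ?_⟩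
    · calc min (r / 2) (min (ρ₃ / 2) (ε / 2)) ≤ ρ₃ / 2 := (min_le_right _ _).trans (min_le_left _ _)
        _ < ρ₃ := by linarith
    · calc min (r / 2) (min (ρ₃ / 2) (ε / 2)) ≤ ε / 2 := (min_le_right _ _).trans (min_le_right _ _)
        _ < ε := by linarith
    · refine hball z ?_ hne
      have h1 : dist z z₀ ≤ r / 2 := (mem_closedBall.1 hz).trans (min_le_left _ _)
      exact mem_ball.2 (by linarith)
  have hcb₁ : closedBall z₀ δ ⊆ ball z₀ ρ₁ := closedBall_subset_ball (hδρ₃.trans_le (min_le_left _ _))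
  have hcb₂ : closedBall z₀ δ ⊆ ball z₀ ρ₂ := closedBall_subset_ball (hδρ₃.trans_le (min_le_right _ _))
  have hcba : closedBall z₀ δ ⊆ ball z₀ ρa := hcb₂.trans (ball_subset_ball hρ₂ρ)
  have hcbρ : closedBall z₀ δ ⊆ ball z₀ ρ := hcb₁.trans (ball_subset_ball hρ₁ρ)
  have hbε : ball z₀ δ ⊆ ball z₀ ε := ball_subset_ball hδε.le
  /- Step 4: the three compactness constants `r`, `M'`, `amin`. -/
  have hΛ₀c : ContinuousOn Λ₀ (closedBall z₀ δ) := hΛ₀d.continuousOn.mono hcb₁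
  obtain ⟨zr, hzr, hzrmin⟩ := (isCompact_sphere z₀ δ).exists_isMinOn
    ⟨z₀ + δ, by simp [hδ.le]⟩ (hΛ₀c.mono sphere_subset_closedBall).norm
  set r := ‖Λ₀ zr‖ with hrdef
  have hrpos : 0 < r := by
    refine norm_pos_iff.2 (hΛ₀ne zr (sphere_subset_closedBall hzr) ?_)
    rintro rfl
    exact hδ.ne (by simpa only [mem_sphere, dist_self] using hzr)
  have hrle : ∀ z ∈ sphere z₀ δ, r ≤ ‖Λ₀ z‖ := fun z hz => hzrmin hz
  have hmc : ContinuousOn m (closedBall z₀ δ) := hmd.continuousOn.mono hcb₂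
  obtain ⟨zM, -, hzMmax⟩ := (isCompact_closedBall z₀ δ).exists_isMaxOn
    ⟨z₀, mem_closedBall_self hδ.le⟩ (hmc.sub continuousOn_const).norm
  set M' := ‖m zM - m z₀‖ with hM'def
  have hM'le : ∀ z ∈ closedBall z₀ δ, ‖m z - m z₀‖ ≤ M' := fun z hz => hzMmax hz
  have hac : ContinuousOn a (closedBall z₀ δ) := ha.continuousOn.mono hcbρ
  obtain ⟨za, hza, hzamin⟩ := (isCompact_closedBall z₀ δ).exists_isMinOn
    ⟨z₀, mem_closedBall_self hδ.le⟩ hac.norm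
  set amin := ‖a za‖ with hamin
  have hamin_pos : 0 < amin := norm_pos_iff.2 (haNe za (hcba hza))
  have hamin_le : ∀ z ∈ closedBall z₀ δ, amin ≤ ‖a z‖ := fun z hz => hzamin hz
  /- Step 5: the corrected logarithm `W t = t Λ + m - (2 k_t + 1) π i` and `h t = W t / t`. -/
  set K₀ : ℝ := Real.pi + ‖m z₀‖ with hK₀
  set k : ℕ → ℤ := fun t => ⌊((t : ℂ) * Λ z₀ + m z₀).im / (2 * Real.pi)⌋ with hk
  set W : ℕ → ℂ → ℂ := fun t z => (t : ℂ) * Λ z + m z - (2 * ((k t : ℤ) : ℂ) + 1) * Real.pi * I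
    with hW
  set h : ℕ → ℂ → ℂ := fun t z => W t z / (t : ℂ) with hh
  have hWz₀ : ∀ t : ℕ, ‖W t z₀‖ ≤ K₀ := by
    intro t
    set s : ℝ := ((t : ℂ) * Λ z₀ + m z₀).im with hs
    have hcI : (2 * ((k t : ℤ) : ℂ) + 1) * Real.pi * I = (((2 * (k t : ℝ) + 1) * Real.pi : ℝ) : ℂ) * I := by
      push_cast; ring
    have hre : (W t z₀).re = (m z₀).re := by
      simp only [hW]; rw [hcI, sub_re, add_re, re_ofReal_mul, I_re, mul_zero, sub_zero, mul_re,
        hReΛ, mul_zero, natCast_im, zero_mul, sub_zero, zero_add]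
    have him : (W t z₀).im = s - (2 * (k t : ℝ) + 1) * Real.pi := by
      simp only [hW]; rw [hcI, sub_im, im_ofReal_mul, I_im, mul_one]
    have himabs : |(W t z₀).im| ≤ Real.pi := by
      rw [him]
      have h2π : 0 < 2 * Real.pi := by positivity
      have hfl : ((k t : ℤ) : ℝ) ≤ s / (2 * Real.pi) := Int.floor_le _
      have hlt : s / (2 * Real.pi) < ((k t : ℤ) : ℝ) + 1 := Int.lt_floor_add_one _
      have h1 : ((k t : ℤ) : ℝ) * (2 * Real.pi) ≤ s := by rwa [le_div_iff₀ h2π] at hfl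
      have h2 : s < (((k t : ℤ) : ℝ) + 1) * (2 * Real.pi) := by rwa [div_lt_iff₀ h2π] at hlt
      rw [abs_le]; constructor <;> nlinarith
    calc ‖W t z₀‖ ≤ |(W t z₀).re| + |(W t z₀).im| := norm_le_abs_re_add_abs_im _
      _ ≤ ‖m z₀‖ + Real.pi := add_le_add (by rw [hre]; exact abs_re_le_norm _) himabs
      _ = K₀ := by rw [hK₀]; ring
  -- the key identity `W t z = t Λ₀ z + W t z₀ + (m z - m z₀)`
  have hWsplit : ∀ (t : ℕ) (z : ℂ), W t z = (t : ℂ) * Λ₀ z + W t z₀ + (m z - m z₀) := by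
    intro t z; simp only [hW, hΛ₀def]; ring
  have hWd : ∀ t : ℕ, DifferentiableOn ℂ (W t) (ball z₀ ρ₃) := fun t =>
    (((hΛd.mono (ball_subset_ball (min_le_left _ _))).const_mul _).add
      (hmd.mono (ball_subset_ball (min_le_right _ _)))).sub_const _
  have hcb₃ : closedBall z₀ δ ⊆ ball z₀ ρ₃ := closedBall_subset_ball hδρ₃
  have hWc : ∀ t : ℕ, ContinuousOn (W t) (closedBall z₀ δ) := fun t => (hWd t).continuousOn.mono hcb₃
  /- Step 6: `h t → Λ₀` uniformly on the closed disc; Hurwitz gives zeros of `W t`. -/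
  have hunif : TendstoUniformlyOn h Λ₀ atTop (closedBall z₀ δ) := by
    refine Metric.tendstoUniformlyOn_iff.2 fun η hη => ?_
    have hlim : Tendsto (fun t : ℕ => (K₀ + M') / (t : ℝ)) atTop (𝓝 0) :=
      tendsto_const_div_atTop_nhds_zero_nat _
    filter_upwards [(tendsto_order.1 hlim).2 η hη, eventually_ge_atTop 1] with t ht ht1 z hz
    have htne : (t : ℂ) ≠ 0 := by exact_mod_cast (ne_of_gt ht1 : t ≠ 0)
    have hdiff : h t z - Λ₀ z = (W t z₀ + (m z - m z₀)) / (t : ℂ) := by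
      simp only [hh]; rw [hWsplit t z]; field_simp; ring
    rw [dist_comm, dist_eq_norm, hdiff, norm_div, Complex.norm_natCast]
    calc ‖W t z₀ + (m z - m z₀)‖ / t ≤ (K₀ + M') / t := by
          gcongr
          exact (norm_add_le _ _).trans (add_le_add (hWz₀ t) (hM'le z hz))
      _ < η := ht
  have hDC : ∀ᶠ t in atTop, DiffContOnCl ℂ (h t) (ball z₀ δ) :=
    Filter.Eventually.of_forall fun t => ((hWd t).div_const _).diffContOnCl_ball hcb₃
  have hsph : ∀ z ∈ sphere z₀ δ, Λ₀ z ≠ 0 := fun z hz => norm_pos_iff.1 (hrpos.trans_le (hrle z hz))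
  have hE1 : ∀ᶠ t in atTop, ∃ z ∈ ball z₀ δ, h t z = 0 :=
    Complex.eventually_exists_zero_mem_ball_of_tendstoUniformlyOn hδ hDC hunif
      (hΛ₀c.mono sphere_subset_closedBall) hΛ₀z₀ hsph
  /- Step 7: the other eventualities in `t`. -/
  have hE2 : ∀ᶠ t : ℕ in atTop, C * θ ^ t / amin < 1 / 8 := by
    have hlim : Tendsto (fun t : ℕ => C * θ ^ t / amin) atTop (𝓝 (C * 0 / amin)) :=
      ((tendsto_pow_atTop_nhds_zero_of_lt_one hθ₀ hθ₁).const_mul C).div_const amin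
    rw [mul_zero, zero_div] at hlim
    exact (tendsto_order.1 hlim).2 _ (by norm_num)
  have hE3 : ∀ᶠ t : ℕ in atTop, 1 + K₀ + M' ≤ (t : ℝ) * r :=
    (tendsto_natCast_atTop_atTop.atTop_mul_const hrpos).eventually_ge_atTop _
  obtain ⟨t₀, ht₀⟩ := eventually_atTop.1 (hE1.and (hE2.and (hE3.and (eventually_ge_atTop 1))))
  refine ⟨t₀, fun t ht => ?_⟩
  obtain ⟨⟨zt, hzt, hzt0⟩, hE2t, hE3t, ht1⟩ := ht₀ t ht
  /- Step 8: fixed large `t`: the open set `U = {‖W t‖ < 1/2} ∩ ball`, its frontier. -/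
  have htne : (t : ℂ) ≠ 0 := by exact_mod_cast (ne_of_gt ht1 : t ≠ 0)
  have hWzt : W t zt = 0 := ((div_eq_zero_iff.1 (hzt0 : W t zt / (t : ℂ) = 0)).resolve_right htne)
  have hWsph : ∀ z ∈ sphere z₀ δ, 1 ≤ ‖W t z‖ := by
    intro z hz
    have hzc : z ∈ closedBall z₀ δ := sphere_subset_closedBall hz
    rw [hWsplit t z]
    have h1 : ‖(t : ℂ) * Λ₀ z‖ = (t : ℝ) * ‖Λ₀ z‖ := by rw [norm_mul, Complex.norm_natCast]
    have h2 : (t : ℝ) * r ≤ (t : ℝ) * ‖Λ₀ z‖ := mul_le_mul_of_nonneg_left (hrle z hz) (Nat.cast_nonneg t)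
    have h3 := norm_sub_norm_le ((t : ℂ) * Λ₀ z) (-(W t z₀ + (m z - m z₀)))
    rw [sub_neg_eq_add, norm_neg, ← add_assoc] at h3
    have h4 := (norm_add_le (W t z₀) (m z - m z₀)).trans (add_le_add (hWz₀ t) (hM'le z hzc))
    linarith
  set U : Set ℂ := ball z₀ δ ∩ W t ⁻¹' ball 0 (1 / 2) with hUdef
  have hUo : IsOpen U := ((hWc t).mono ball_subset_closedBall).isOpen_inter_preimage
    isOpen_ball isOpen_ball
  have hUsub : U ⊆ ball z₀ δ := inter_subset_left
  have hUbdd : Bornology.IsBounded U := isBounded_ball.subset hUsub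
  have hztU : zt ∈ U := ⟨hzt, by simp [hWzt]⟩
  have hKcl : IsClosed (closedBall z₀ δ ∩ W t ⁻¹' closedBall 0 (1 / 2)) :=
    (hWc t).preimage_isClosed_of_isClosed isClosed_closedBall isClosed_closedBall
  have hclU : closure U ⊆ closedBall z₀ δ ∩ W t ⁻¹' closedBall 0 (1 / 2) :=
    closure_minimal (inter_subset_inter ball_subset_closedBall
      (preimage_mono ball_subset_closedBall)) hKcl
  have hfrW : ∀ z ∈ frontier U, ‖W t z‖ = 1 / 2 := by
    intro z hz
    have hzcl : z ∈ closure U := frontier_subset_closure hz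
    have hzU : z ∉ U := by rw [hUo.frontier_eq] at hz; exact hz.2
    obtain ⟨hz1, hz2⟩ := hclU hzcl
    rw [mem_preimage, mem_closedBall, dist_zero_right] at hz2
    rcases (mem_closedBall.1 hz1).lt_or_eq with hlt | heqδ
    · have h3 : ¬ ‖W t z‖ < 1 / 2 := fun h4 => hzU ⟨mem_ball.2 hlt, by
        rw [mem_preimage, mem_ball, dist_zero_right]; exact h4⟩
      linarith [not_lt.1 h3]
    · linarith [hWsph z (mem_sphere.2 heqδ)]
  /- Step 9: the normalised function `G` and the maximum modulus principle for `1/G`. -/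
  set G : ℂ → ℂ := fun z => 1 - exp (W t z) + R t z / (a z * l₀ z ^ t) with hGdef
  have hεle : ∀ z ∈ closedBall z₀ δ, ‖R t z / (a z * l₀ z ^ t)‖ ≤ C * θ ^ t / amin := by
    intro z hz
    have hzρ : z ∈ ball z₀ ρ := hcbρ hz
    have hl₀p : 0 < ‖l₀ z‖ ^ t := pow_pos (norm_pos_iff.2 (hl₀ne z hzρ)) t
    have hap : 0 < ‖a z‖ := hamin_pos.trans_le (hamin_le z hz)
    rw [norm_div, norm_mul, norm_pow, div_le_div_iff₀ (mul_pos hap hl₀p) hamin_pos]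
    calc ‖R t z‖ * amin ≤ (C * θ ^ t * ‖l₀ z‖ ^ t) * ‖a z‖ :=
          mul_le_mul (hRle t z hzρ) (hamin_le z hz) hamin_pos.le (by positivity)
      _ = C * θ ^ t * (‖a z‖ * ‖l₀ z‖ ^ t) := by ring
  have hGfr : ∀ z ∈ frontier U, 1 / 8 ≤ ‖G z‖ := by
    intro z hz
    have hzc : z ∈ closedBall z₀ δ := (hclU (frontier_subset_closure hz)).1
    have h1 : 1 / 4 ≤ ‖1 - exp (W t z)‖ := norm_one_sub_exp_ge_quarter (hfrW z hz)
    have h2 := hεle z hzc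
    have h3 := norm_sub_norm_le (1 - exp (W t z)) (-(R t z / (a z * l₀ z ^ t)))
    rw [sub_neg_eq_add, norm_neg] at h3
    simp only [hGdef]
    linarith
  have hGzt : ‖G zt‖ < 1 / 8 := by
    simp only [hGdef]; rw [hWzt, exp_zero, sub_self, zero_add]
    exact (hεle zt (ball_subset_closedBall hzt)).trans_lt hE2t
  -- holomorphy of `G` on an open neighbourhood of the closed disc
  set V : Set ℂ := ball z₀ ρ₃ ∩ ball z₀ ρa with hVdef
  have hcbV : closedBall z₀ δ ⊆ V := subset_inter hcb₃ hcba
  have hVρ : V ⊆ ball z₀ ρ := inter_subset_left.trans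
    ((ball_subset_ball (min_le_left _ _)).trans (ball_subset_ball hρ₁ρ))
  have hGd : DifferentiableOn ℂ G V := by
    refine (((hWd t).mono inter_subset_left).cexp.const_sub 1).add ?_
    refine ((hR t).mono hVρ).div (((ha.mono hVρ)).mul ((hl₀.mono hVρ).pow t)) fun z hz => ?_
    exact mul_ne_zero (haNe z hz.2) (pow_ne_zero _ (hl₀ne z (hVρ hz)))
  have hexists : ∃ z ∈ U, G z = 0 := by
    by_contra hcon
    push Not at hcon
    have hne' : ∀ z ∈ closure U, G z ≠ 0 := by
      intro z hz
      rw [closure_eq_self_union_frontier] at hz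
      rcases hz with hz | hz
      · exact hcon z hz
      · intro h0
        linarith [(h0 ▸ hGfr z hz : (1 : ℝ) / 8 ≤ ‖(0 : ℂ)‖), norm_zero (E := ℂ)]
    have hGdc : DiffContOnCl ℂ G U :=
      ⟨hGd.mono (hUsub.trans (ball_subset_closedBall.trans hcbV)),
        hGd.continuousOn.mono (hclU.trans (inter_subset_left.trans hcbV))⟩
    have hinv : DiffContOnCl ℂ G⁻¹ U := hGdc.inv hne'
    have hbound : ∀ z ∈ frontier U, ‖G⁻¹ z‖ ≤ 8 := by
      intro z hz
      rw [Pi.inv_apply, norm_inv]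
      calc ‖G z‖⁻¹ ≤ (1 / 8)⁻¹ := inv_anti₀ (by norm_num) (hGfr z hz)
        _ = 8 := by norm_num
    have key := norm_le_of_forall_mem_frontier_norm_le hUbdd hinv hbound (subset_closure hztU)
    rw [Pi.inv_apply, norm_inv] at key
    have hpos : 0 < ‖G zt‖ := norm_pos_iff.2 (hne' zt (subset_closure hztU))
    have h3 : (8 : ℝ)⁻¹ ≤ ‖G zt‖ := (inv_le_comm₀ hpos (by norm_num : (0:ℝ) < 8)).1 key
    linarith
  /- Step 10: a zero of `G` in `U` is a zero of `a l₀^t + b l₁^t + R t` in `ball z₀ ε`. -/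
  obtain ⟨z, hzU, hGz⟩ := hexists
  have hzδ : z ∈ ball z₀ δ := hUsub hzU
  have hzc : z ∈ closedBall z₀ δ := ball_subset_closedBall hzδ
  have hzρ : z ∈ ball z₀ ρ := hcbρ hzc
  refine ⟨z, hbε hzδ, ?_⟩
  have haz : a z ≠ 0 := haNe z (hcba hzc)
  have hl₀z : l₀ z ≠ 0 := hl₀ne z hzρ
  have hexpW : exp (W t z) = -(ψ z * φ z ^ t) := by
    simp only [hW]
    rw [exp_sub_odd_mul_pi_mul_I, exp_add, Complex.exp_nat_mul, hΛexp z (hcb₁ hzc), hmexp z (hcb₂ hzc)]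
    ring
  have hG0 : 1 + ψ z * φ z ^ t + R t z / (a z * l₀ z ^ t) = 0 := by
    have h1 : G z = 1 + ψ z * φ z ^ t + R t z / (a z * l₀ z ^ t) := by
      simp only [hGdef]; rw [hexpW]; ring
    rw [← h1, hGz]
  have h2 : a z * l₀ z ^ t + b z * l₁ z ^ t + R t z =
      a z * l₀ z ^ t * (1 + ψ z * φ z ^ t + R t z / (a z * l₀ z ^ t)) := by
    have hl₀t : l₀ z ^ t ≠ 0 := pow_ne_zero _ hl₀z
    simp only [hψ, hφ, div_pow]
    field_simp
  rw [h2, hG0, mul_zero]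

end Literature.Analysis.Complex
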